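import Mathlib

/-!
# Crux `HiddenCorners` (stmt-MatrixMultiplication-7492) · line `Sketch` · stub `stub_gapped_generators`

Gapped Toeplitz sections are Toeplitz-like with short, sparse split Stein generators.

Fix index maps `ρ γ : Fin N → ℤ` which step by exactly `1` from index `i − 1` to `i` except at the
"break" indices collected in `R₀` (rows) resp. `C₀` (columns), both containing index `0` and both of
size `≤ d`.  For `c : ℤ` the 0/1 section `T i j = [ρ i − γ j = c]` and the lower shift `Z`
(`Z i j = [i = j + 1]`) satisfy: the displacement `D = T − Z T Zᵀ` vanishes off the break rows and
break columns (`gg_disp_eq_zero`), and when `ρ`, `γ` are injective every row and every column of `D`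
has at most two nonzero entries (`gg_disp_row_card_le_two`, `gg_disp_col_card_le_two`).

Enumerating the breaks by a partial map `Fin d → Option (Fin N)` (`gg_exists_enum`) we take
`G₀`, `H₀` = the unit columns at the enumerated break rows / columns, `H₁` = the break rows of `D`
and `G₁` = the break columns of `D` with the break rows zeroed; then `D = G₀ H₁ᵀ + G₁ H₀ᵀ`
(`gg_assemble`) and `nnz G₁ + nnz H₁ ≤ 2d + 2d` (`gg_nnz_le`), whence the total sparsity bound
`4 · d · r²` over the `r²` symbol pairs `c = α a + β b`.

Everything is elementary bookkeeping with Mathlib's `Matrix` / `Finset` API; no new definitions.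
-/

-- The summit-side namespace `Summit.MatrixMultiplication.MatrixMultiplication.…` (summit = problem)
-- repeats a component by design (D-0017 layout); silence the duplicate-namespace linter.
set_option linter.dupNamespace false

namespace Summit.MatrixMultiplication.MatrixMultiplication.Cruxes.HiddenCorners.Sketch

open scoped BigOperators Matrix

/-- Entry `(k + 1, l + 1)` of `Z T Zᵀ` (`Z` the lower shift) is `T k l`. [folklore] -/
private theorem gg_shift_apply_succ {N : ℕ} (T : Matrix (Fin N) (Fin N) ℂ) {i j k l : Fin N}
    (hik : (i : ℕ) = k + 1) (hjl : (j : ℕ) = l + 1) :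
    ((Matrix.of fun i j : Fin N => if (i : ℕ) = (j : ℕ) + 1 then (1 : ℂ) else 0) * T *
      (Matrix.of fun i j : Fin N => if (i : ℕ) = (j : ℕ) + 1 then (1 : ℂ) else 0)ᵀ) i j = T k l := by
  have h1 : ∀ k' : Fin N, ((i : ℕ) = (k' : ℕ) + 1) ↔ k' = k := fun k' =>
    ⟨fun h => Fin.ext (by omega), fun h => by rw [h]; exact hik⟩
  have h2 : ∀ l' : Fin N, ((j : ℕ) = (l' : ℕ) + 1) ↔ l' = l := fun l' =>
    ⟨fun h => Fin.ext (by omega), fun h => by rw [h]; exact hjl⟩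
  simp only [Matrix.mul_apply, Matrix.transpose_apply, Matrix.of_apply, h1, h2]
  simp

/-- A nonzero entry of `Z T Zᵀ` sits at a position `(k + 1, l + 1)` with `T k l ≠ 0`. [folklore] -/
private theorem gg_shift_apply_ne_zero {N : ℕ} (T : Matrix (Fin N) (Fin N) ℂ) {i j : Fin N}
    (h : ((Matrix.of fun i j : Fin N => if (i : ℕ) = (j : ℕ) + 1 then (1 : ℂ) else 0) * T *
      (Matrix.of fun i j : Fin N => if (i : ℕ) = (j : ℕ) + 1 then (1 : ℂ) else 0)ᵀ) i j ≠ 0) :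
    ∃ k l : Fin N, (i : ℕ) = k + 1 ∧ (j : ℕ) = l + 1 ∧ T k l ≠ 0 := by
  simp only [Matrix.mul_apply, Matrix.transpose_apply, Matrix.of_apply] at h
  obtain ⟨l, -, hl⟩ := Finset.exists_ne_zero_of_sum_ne_zero h
  obtain ⟨hl1, hl2⟩ := mul_ne_zero_iff.mp hl
  have hjl : (j : ℕ) = l + 1 := by
    by_contra hne
    exact hl2 (if_neg hne)
  obtain ⟨k, -, hk⟩ := Finset.exists_ne_zero_of_sum_ne_zero hl1
  obtain ⟨hk1, hk2⟩ := mul_ne_zero_iff.mp hk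
  have hik : (i : ℕ) = k + 1 := by
    by_contra hne
    exact hk1 (if_neg hne)
  exact ⟨k, l, hik, hjl, hk2⟩

/-- Off the break rows `R₀` and the break columns `C₀` the displacement `T − Z T Zᵀ` of a gapped
Toeplitz section `T i j = [ρ i − γ j = c]` vanishes. [folklore] -/
private theorem gg_disp_eq_zero {N : ℕ} (ρ γ : Fin N → ℤ) (c : ℤ) (R₀ C₀ : Finset (Fin N))
    (h0R : ∀ i : Fin N, (i : ℕ) = 0 → i ∈ R₀) (h0C : ∀ j : Fin N, (j : ℕ) = 0 → j ∈ C₀)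
    (hstepR : ∀ i i' : Fin N, (i : ℕ) = i' + 1 → i ∉ R₀ → ρ i = ρ i' + 1)
    (hstepC : ∀ j j' : Fin N, (j : ℕ) = j' + 1 → j ∉ C₀ → γ j = γ j' + 1)
    {i j : Fin N} (hi : i ∉ R₀) (hj : j ∉ C₀) :
    ((Matrix.of fun i j : Fin N => if ρ i - γ j = c then (1 : ℂ) else 0)
      - (Matrix.of fun i j : Fin N => if (i : ℕ) = (j : ℕ) + 1 then (1 : ℂ) else 0)
        * (Matrix.of fun i j : Fin N => if ρ i - γ j = c then (1 : ℂ) else 0)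
        * (Matrix.of fun i j : Fin N => if (i : ℕ) = (j : ℕ) + 1 then (1 : ℂ) else 0)ᵀ) i j = 0 := by
  have hi0 : (i : ℕ) ≠ 0 := fun h => hi (h0R i h)
  have hj0 : (j : ℕ) ≠ 0 := fun h => hj (h0C j h)
  obtain ⟨k, hik⟩ : ∃ k : Fin N, (i : ℕ) = k + 1 :=
    ⟨⟨(i : ℕ) - 1, by omega⟩, by show (i : ℕ) = (i : ℕ) - 1 + 1; omega⟩
  obtain ⟨l, hjl⟩ : ∃ l : Fin N, (j : ℕ) = l + 1 :=
    ⟨⟨(j : ℕ) - 1, by omega⟩, by show (j : ℕ) = (j : ℕ) - 1 + 1; omega⟩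
  rw [Matrix.sub_apply, gg_shift_apply_succ _ hik hjl]
  simp only [Matrix.of_apply]
  rw [hstepR i k hik hi, hstepC j l hjl hj, add_sub_add_right_eq_sub, sub_self]

/-- Each row of a gapped section `[ρ i − γ j = c]` has at most one nonzero entry when `γ` is
injective. [folklore] -/
private theorem gg_row_card_le_one {N : ℕ} (ρ γ : Fin N → ℤ) (c : ℤ) (hγ : Function.Injective γ)
    (i : Fin N) :
    (Finset.univ.filter fun j : Fin N =>
      (Matrix.of fun i j : Fin N => if ρ i - γ j = c then (1 : ℂ) else 0) i j ≠ 0).card ≤ 1 := by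
  refine Finset.card_le_one.mpr fun j hj j' hj' => ?_
  simp only [Finset.mem_filter, Finset.mem_univ, true_and, Matrix.of_apply, ne_eq,
    ite_eq_right_iff, one_ne_zero, imp_false, not_not] at hj hj'
  exact hγ (by omega)

/-- Each column of a gapped section `[ρ i − γ j = c]` has at most one nonzero entry when `ρ` is
injective. [folklore] -/
private theorem gg_col_card_le_one {N : ℕ} (ρ γ : Fin N → ℤ) (c : ℤ) (hρ : Function.Injective ρ)
    (j : Fin N) :
    (Finset.univ.filter fun i : Fin N =>
      (Matrix.of fun i j : Fin N => if ρ i - γ j = c then (1 : ℂ) else 0) i j ≠ 0).card ≤ 1 := by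
  refine Finset.card_le_one.mpr fun i hi i' hi' => ?_
  simp only [Finset.mem_filter, Finset.mem_univ, true_and, Matrix.of_apply, ne_eq,
    ite_eq_right_iff, one_ne_zero, imp_false, not_not] at hi hi'
  exact hρ (by omega)

/-- If every row of `T` has at most one nonzero entry, every row of `T − Z T Zᵀ` has at most two.
[folklore] -/
private theorem gg_disp_row_card_le_two {N : ℕ} (T : Matrix (Fin N) (Fin N) ℂ)
    (hT : ∀ i, (Finset.univ.filter fun j : Fin N => T i j ≠ 0).card ≤ 1) (i : Fin N) :
    (Finset.univ.filter fun j : Fin N =>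
      (T - (Matrix.of fun i j : Fin N => if (i : ℕ) = (j : ℕ) + 1 then (1 : ℂ) else 0) * T *
        (Matrix.of fun i j : Fin N => if (i : ℕ) = (j : ℕ) + 1 then (1 : ℂ) else 0)ᵀ) i j ≠ 0).card
      ≤ 2 := by
  set Z : Matrix (Fin N) (Fin N) ℂ :=
    Matrix.of fun i j : Fin N => if (i : ℕ) = (j : ℕ) + 1 then (1 : ℂ) else 0 with hZ
  have hB : (Finset.univ.filter fun j : Fin N => (Z * T * Zᵀ) i j ≠ 0).card ≤ 1 := by
    refine Finset.card_le_one.mpr fun j hj j' hj' => ?_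
    simp only [Finset.mem_filter, Finset.mem_univ, true_and] at hj hj'
    obtain ⟨k, l, hik, hjl, hkl⟩ := gg_shift_apply_ne_zero T hj
    obtain ⟨k', l', hik', hjl', hkl'⟩ := gg_shift_apply_ne_zero T hj'
    have hkk : k' = k := Fin.ext (by omega)
    subst hkk
    have hll : l = l' :=
      Finset.card_le_one.mp (hT k') l (by simpa using hkl) l' (by simpa using hkl')
    subst hll
    exact Fin.ext (by omega)
  calc (Finset.univ.filter fun j : Fin N => (T - Z * T * Zᵀ) i j ≠ 0).card
      ≤ ((Finset.univ.filter fun j : Fin N => T i j ≠ 0) ∪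
          (Finset.univ.filter fun j : Fin N => (Z * T * Zᵀ) i j ≠ 0)).card := by
        refine Finset.card_le_card fun j hj => ?_
        simp only [Finset.mem_filter, Finset.mem_univ, true_and, Finset.mem_union,
          Matrix.sub_apply] at hj ⊢
        by_contra h
        push Not at h
        exact hj (by rw [h.1, h.2, sub_zero])
    _ ≤ (Finset.univ.filter fun j : Fin N => T i j ≠ 0).card +
          (Finset.univ.filter fun j : Fin N => (Z * T * Zᵀ) i j ≠ 0).card :=
        Finset.card_union_le _ _
    _ ≤ 1 + 1 := add_le_add (hT i) hB

/-- Transposing swaps the roles of rows and columns in the displacement `T − Z T Zᵀ`. [folklore] -/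
private theorem gg_disp_transpose_apply {N : ℕ} (T : Matrix (Fin N) (Fin N) ℂ) (i j : Fin N) :
    (T - (Matrix.of fun i j : Fin N => if (i : ℕ) = (j : ℕ) + 1 then (1 : ℂ) else 0) * T *
        (Matrix.of fun i j : Fin N => if (i : ℕ) = (j : ℕ) + 1 then (1 : ℂ) else 0)ᵀ) i j =
      (Tᵀ - (Matrix.of fun i j : Fin N => if (i : ℕ) = (j : ℕ) + 1 then (1 : ℂ) else 0) * Tᵀ *
        (Matrix.of fun i j : Fin N => if (i : ℕ) = (j : ℕ) + 1 then (1 : ℂ) else 0)ᵀ) j i := by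
  set Z : Matrix (Fin N) (Fin N) ℂ :=
    Matrix.of fun i j : Fin N => if (i : ℕ) = (j : ℕ) + 1 then (1 : ℂ) else 0 with hZ
  have h : T - Z * T * Zᵀ = (Tᵀ - Z * Tᵀ * Zᵀ)ᵀ := by
    simp only [Matrix.transpose_sub, Matrix.transpose_mul, Matrix.transpose_transpose,
      Matrix.mul_assoc]
  rw [h, Matrix.transpose_apply]

/-- If every column of `T` has at most one nonzero entry, every column of `T − Z T Zᵀ` has at most
two. [folklore] -/
private theorem gg_disp_col_card_le_two {N : ℕ} (T : Matrix (Fin N) (Fin N) ℂ)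
    (hT : ∀ j, (Finset.univ.filter fun i : Fin N => T i j ≠ 0).card ≤ 1) (j : Fin N) :
    (Finset.univ.filter fun i : Fin N =>
      (T - (Matrix.of fun i j : Fin N => if (i : ℕ) = (j : ℕ) + 1 then (1 : ℂ) else 0) * T *
        (Matrix.of fun i j : Fin N => if (i : ℕ) = (j : ℕ) + 1 then (1 : ℂ) else 0)ᵀ) i j ≠ 0).card
      ≤ 2 := by
  have h := gg_disp_row_card_le_two Tᵀ (fun i => by simpa [Matrix.transpose_apply] using hT i) j
  calc _ = (Finset.univ.filter fun i : Fin N =>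
        (Tᵀ - (Matrix.of fun i j : Fin N => if (i : ℕ) = (j : ℕ) + 1 then (1 : ℂ) else 0) * Tᵀ *
          (Matrix.of fun i j : Fin N => if (i : ℕ) = (j : ℕ) + 1 then (1 : ℂ) else 0)ᵀ) j i ≠ 0).card := by
        congr 1
        ext i
        simp only [Finset.mem_filter, Finset.mem_univ, true_and, gg_disp_transpose_apply T i j]
    _ ≤ 2 := h

/-- A `Fin N × Fin d` matrix whose `d` columns each have at most two nonzero entries has at most
`2 d` nonzero entries. [folklore] -/
private theorem gg_nnz_le {N d : ℕ} (M : Matrix (Fin N) (Fin d) ℂ)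
    (h : ∀ k, (Finset.univ.filter fun i : Fin N => M i k ≠ 0).card ≤ 2) :
    (Finset.univ.filter fun p : Fin N × Fin d => M p.1 p.2 ≠ 0).card ≤ 2 * d := by
  rw [Finset.card_filter, Fintype.sum_prod_type_right]
  calc _ ≤ ∑ _k : Fin d, 2 := Finset.sum_le_sum fun k _ => ?_
    _ = 2 * d := by simp [mul_comm]
  have hk := h k
  rw [Finset.card_filter] at hk
  simpa using hk

/-- A finset of `Fin N` of size `≤ d` is enumerated without repetition by a partial map from
`Fin d`. [folklore] -/
private theorem gg_exists_enum {N d : ℕ} (S : Finset (Fin N)) (hS : S.card ≤ d) :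
    ∃ e : Fin d → Option (Fin N), (∀ k x, e k = some x → x ∈ S) ∧ (∀ x ∈ S, ∃ k, e k = some x) ∧
      (∀ k k' x, e k = some x → e k' = some x → k = k') := by
  refine ⟨fun k => if h : (k : ℕ) < S.card then some (S.orderEmbOfFin rfl ⟨k, h⟩) else none,
    ?_, ?_, ?_⟩
  · intro k x hk
    by_cases h : (k : ℕ) < S.card
    · simp only [h, dite_true, Option.some.injEq] at hk
      rw [← hk]
      exact Finset.orderEmbOfFin_mem _ _ _
    · simp [h] at hk
  · intro x hx
    have hx' : x ∈ Set.range (S.orderEmbOfFin rfl) := by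
      rw [Finset.range_orderEmbOfFin]; exact hx
    obtain ⟨m, hm⟩ := hx'
    refine ⟨Fin.castLE hS m, ?_⟩
    simp [hm]
  · intro k k' x hk hk'
    by_cases h : (k : ℕ) < S.card
    · by_cases h' : (k' : ℕ) < S.card
      · simp only [h, h', dite_true, Option.some.injEq] at hk hk'
        have hkk := (S.orderEmbOfFin rfl).injective (hk.trans hk'.symm)
        exact Fin.ext (by simpa using congrArg Fin.val hkk)
      · simp [h'] at hk'
    · simp [h] at hk

/-- Split Stein assembly: a matrix `D` supported on the rows `R₀` and the columns `C₀` equals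
`G₀ H₁ᵀ + G₁ H₀ᵀ`, where `G₀`, `H₀` are the unit columns at the enumerated break rows / columns,
`H₁` collects the break rows of `D`, and `G₁` the break columns of `D` with the break rows zeroed.
[folklore] -/
private theorem gg_assemble {N d : ℕ} (D : Matrix (Fin N) (Fin N) ℂ) (R₀ C₀ : Finset (Fin N))
    (eR eC : Fin d → Option (Fin N))
    (hD : ∀ i j, i ∉ R₀ → j ∉ C₀ → D i j = 0)
    (hRm : ∀ k x, eR k = some x → x ∈ R₀) (hRe : ∀ x ∈ R₀, ∃ k, eR k = some x)
    (hRu : ∀ k k' x, eR k = some x → eR k' = some x → k = k')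
    (hCm : ∀ k y, eC k = some y → y ∈ C₀) (hCe : ∀ y ∈ C₀, ∃ k, eC k = some y)
    (hCu : ∀ k k' y, eC k = some y → eC k' = some y → k = k') :
    D = (Matrix.of fun (i : Fin N) (k : Fin d) => if eR k = some i then (1 : ℂ) else 0)
          * (Matrix.of fun (j : Fin N) (k : Fin d) => (eR k).elim 0 fun x => D x j)ᵀ
        + (Matrix.of fun (i : Fin N) (k : Fin d) =>
            (eC k).elim 0 fun y => if i ∈ R₀ then 0 else D i y)
          * (Matrix.of fun (j : Fin N) (k : Fin d) => if eC k = some j then (1 : ℂ) else 0)ᵀ := by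
  ext i j
  have h1 : ((Matrix.of fun (i : Fin N) (k : Fin d) => if eR k = some i then (1 : ℂ) else 0)
      * (Matrix.of fun (j : Fin N) (k : Fin d) => (eR k).elim 0 fun x => D x j)ᵀ) i j
      = if i ∈ R₀ then D i j else 0 := by
    simp only [Matrix.mul_apply, Matrix.transpose_apply, Matrix.of_apply]
    by_cases hi : i ∈ R₀
    · obtain ⟨k₀, hk₀⟩ := hRe i hi
      rw [if_pos hi, Finset.sum_eq_single k₀]
      · simp [hk₀]
      · intro k _ hk
        have hne : eR k ≠ some i := fun h => hk (hRu k k₀ i h hk₀)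
        simp [hne]
      · simp
    · rw [if_neg hi]
      refine Finset.sum_eq_zero fun k _ => ?_
      have hne : eR k ≠ some i := fun h => hi (hRm k i h)
      simp [hne]
  have h2 : ((Matrix.of fun (i : Fin N) (k : Fin d) =>
        (eC k).elim 0 fun y => if i ∈ R₀ then 0 else D i y)
      * (Matrix.of fun (j : Fin N) (k : Fin d) => if eC k = some j then (1 : ℂ) else 0)ᵀ) i j
      = if j ∈ C₀ then (if i ∈ R₀ then 0 else D i j) else 0 := by
    simp only [Matrix.mul_apply, Matrix.transpose_apply, Matrix.of_apply]
    by_cases hj : j ∈ C₀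
    · obtain ⟨k₀, hk₀⟩ := hCe j hj
      rw [if_pos hj, Finset.sum_eq_single k₀]
      · simp [hk₀]
      · intro k _ hk
        have hne : eC k ≠ some j := fun h => hk (hCu k k₀ j h hk₀)
        simp [hne]
      · simp
    · rw [if_neg hj]
      refine Finset.sum_eq_zero fun k _ => ?_
      have hne : eC k ≠ some j := fun h => hj (hCm k j h)
      simp [hne]
  rw [Matrix.add_apply, h1, h2]
  by_cases hi : i ∈ R₀
  · simp [hi]
  · by_cases hj : j ∈ C₀
    · simp [hi, hj]
    · simp [hi, hj, hD i j hi hj]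

/-- One symbol pair: for the gapped section `T = [ρ i − γ j = c]` and its displacement
`D = T − Z T Zᵀ`, the split Stein identity with the generators of `gg_assemble`, and the sparsity
bound `nnz G₁ + nnz H₁ ≤ 4 d`. [folklore] -/
private theorem gg_pair {N d : ℕ} (ρ γ : Fin N → ℤ) (c : ℤ) (R₀ C₀ : Finset (Fin N))
    (h0R : ∀ i : Fin N, (i : ℕ) = 0 → i ∈ R₀) (h0C : ∀ j : Fin N, (j : ℕ) = 0 → j ∈ C₀)
    (hstepR : ∀ i i' : Fin N, (i : ℕ) = i' + 1 → i ∉ R₀ → ρ i = ρ i' + 1)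
    (hstepC : ∀ j j' : Fin N, (j : ℕ) = j' + 1 → j ∉ C₀ → γ j = γ j' + 1)
    (hρ : Function.Injective ρ) (hγ : Function.Injective γ)
    (eR eC : Fin d → Option (Fin N))
    (hRm : ∀ k x, eR k = some x → x ∈ R₀) (hRe : ∀ x ∈ R₀, ∃ k, eR k = some x)
    (hRu : ∀ k k' x, eR k = some x → eR k' = some x → k = k')
    (hCm : ∀ k y, eC k = some y → y ∈ C₀) (hCe : ∀ y ∈ C₀, ∃ k, eC k = some y)
    (hCu : ∀ k k' y, eC k = some y → eC k' = some y → k = k')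
    (T Z D : Matrix (Fin N) (Fin N) ℂ)
    (hT : T = Matrix.of fun i j : Fin N => if ρ i - γ j = c then (1 : ℂ) else 0)
    (hZ : Z = Matrix.of fun i j : Fin N => if (i : ℕ) = (j : ℕ) + 1 then (1 : ℂ) else 0)
    (hD : D = T - Z * T * Zᵀ) :
    D = (Matrix.of fun (i : Fin N) (k : Fin d) => if eR k = some i then (1 : ℂ) else 0)
          * (Matrix.of fun (j : Fin N) (k : Fin d) => (eR k).elim 0 fun x => D x j)ᵀ
        + (Matrix.of fun (i : Fin N) (k : Fin d) =>
            (eC k).elim 0 fun y => if i ∈ R₀ then 0 else D i y)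
          * (Matrix.of fun (j : Fin N) (k : Fin d) => if eC k = some j then (1 : ℂ) else 0)ᵀ ∧
    (Finset.univ.filter fun p : Fin N × Fin d =>
        (Matrix.of fun (i : Fin N) (k : Fin d) =>
          (eC k).elim 0 fun y => if i ∈ R₀ then 0 else D i y) p.1 p.2 ≠ 0).card
      + (Finset.univ.filter fun p : Fin N × Fin d =>
        (Matrix.of fun (j : Fin N) (k : Fin d) => (eR k).elim 0 fun x => D x j) p.1 p.2 ≠ 0).card
      ≤ 4 * d := by
  subst hD hT hZ
  have hrow := gg_disp_row_card_le_two _ (gg_row_card_le_one ρ γ c hγ)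
  have hcol := gg_disp_col_card_le_two _ (gg_col_card_le_one ρ γ c hρ)
  refine ⟨gg_assemble _ R₀ C₀ eR eC
    (fun i j hi hj => gg_disp_eq_zero ρ γ c R₀ C₀ h0R h0C hstepR hstepC hi hj)
    hRm hRe hRu hCm hCe hCu, ?_⟩
  have hG : (Finset.univ.filter fun p : Fin N × Fin d =>
      (Matrix.of fun (i : Fin N) (k : Fin d) => (eC k).elim 0 fun y => if i ∈ R₀ then 0 else
        ((Matrix.of fun i j : Fin N => if ρ i - γ j = c then (1 : ℂ) else 0)
          - (Matrix.of fun i j : Fin N => if (i : ℕ) = (j : ℕ) + 1 then (1 : ℂ) else 0)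
            * (Matrix.of fun i j : Fin N => if ρ i - γ j = c then (1 : ℂ) else 0)
            * (Matrix.of fun i j : Fin N => if (i : ℕ) = (j : ℕ) + 1 then (1 : ℂ) else 0)ᵀ) i y)
        p.1 p.2 ≠ 0).card ≤ 2 * d := by
    refine gg_nnz_le _ fun k => ?_
    simp only [Matrix.of_apply]
    cases hk : eC k with
    | none => simp
    | some y =>
      simp only [Option.elim_some]
      refine le_trans (Finset.card_le_card fun i hi => ?_) (hcol y)
      simp only [Finset.mem_filter, Finset.mem_univ, true_and] at hi ⊢
      intro h0
      exact hi (by simp [h0])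
  have hH : (Finset.univ.filter fun p : Fin N × Fin d =>
      (Matrix.of fun (j : Fin N) (k : Fin d) => (eR k).elim 0 fun x =>
        ((Matrix.of fun i j : Fin N => if ρ i - γ j = c then (1 : ℂ) else 0)
          - (Matrix.of fun i j : Fin N => if (i : ℕ) = (j : ℕ) + 1 then (1 : ℂ) else 0)
            * (Matrix.of fun i j : Fin N => if ρ i - γ j = c then (1 : ℂ) else 0)
            * (Matrix.of fun i j : Fin N => if (i : ℕ) = (j : ℕ) + 1 then (1 : ℂ) else 0)ᵀ) x j)
        p.1 p.2 ≠ 0).card ≤ 2 * d := by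
    refine gg_nnz_le _ fun k => ?_
    simp only [Matrix.of_apply]
    cases hk : eR k with
    | none => simp
    | some x =>
      simp only [Option.elim_some]
      exact hrow x
  calc _ ≤ 2 * d + 2 * d := add_le_add hG hH
    _ = 4 * d := by ring

/-- STUB 2 of the `Sketch` skeleton of crux `HiddenCorners` — gapped Toeplitz sections are
Toeplitz-like with short, sparse split Stein generators.  For index maps `ρ`, `γ` that step by one
except at the breaks `R₀`, `C₀` (both containing index `0`, both of size `≤ d`) and are injective,
the 0/1 pencil `T a b i j = [ρ i − γ j = α a + β b]` satisfies the crux's displacement identity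
`T_ab − Z T_ab Zᵀ = G₀ (H₁)_abᵀ + (G₁)_ab H₀ᵀ` with `G₀`, `H₀` = unit vectors at the breaks, and the
`X`-dependent generators have at most `4 d` nonzero entries per `(a, b)`, `4 · d · r²` in total.
[folklore] -/
theorem stub_gapped_generators (r N d : ℕ) (ρ γ : Fin N → ℤ) (α β : Fin r → ℤ)
    (R₀ C₀ : Finset (Fin N)) (hR : R₀.card ≤ d) (hC : C₀.card ≤ d)
    (h0R : ∀ i : Fin N, (i : ℕ) = 0 → i ∈ R₀) (h0C : ∀ j : Fin N, (j : ℕ) = 0 → j ∈ C₀)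
    (hstepR : ∀ i i' : Fin N, (i : ℕ) = i' + 1 → i ∉ R₀ → ρ i = ρ i' + 1)
    (hstepC : ∀ j j' : Fin N, (j : ℕ) = j' + 1 → j ∉ C₀ → γ j = γ j' + 1)
    (hρ : Function.Injective ρ) (hγ : Function.Injective γ) :
    ∃ (G₀ H₀ : Matrix (Fin N) (Fin d) ℂ) (G₁ H₁ : Fin r → Fin r → Matrix (Fin N) (Fin d) ℂ),
      (∀ a b : Fin r,
        (Matrix.of fun i j : Fin N => if ρ i - γ j = α a + β b then (1 : ℂ) else 0)
          - (Matrix.of fun i j : Fin N => if (i : ℕ) = (j : ℕ) + 1 then (1 : ℂ) else 0)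
            * (Matrix.of fun i j : Fin N => if ρ i - γ j = α a + β b then (1 : ℂ) else 0)
            * (Matrix.of fun i j : Fin N => if (i : ℕ) = (j : ℕ) + 1 then (1 : ℂ) else 0)ᵀ
          = G₀ * (H₁ a b)ᵀ + G₁ a b * H₀ᵀ) ∧
      (∑ a : Fin r, ∑ b : Fin r,
          ((Finset.univ.filter fun p : Fin N × Fin d => G₁ a b p.1 p.2 ≠ 0).card
            + (Finset.univ.filter fun p : Fin N × Fin d => H₁ a b p.1 p.2 ≠ 0).card) : ℕ)
        ≤ 4 * d * r ^ 2 := by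
  obtain ⟨eR, hRm, hRe, hRu⟩ := gg_exists_enum R₀ hR
  obtain ⟨eC, hCm, hCe, hCu⟩ := gg_exists_enum C₀ hC
  have key := fun a b : Fin r => gg_pair ρ γ (α a + β b) R₀ C₀ h0R h0C hstepR hstepC hρ hγ eR eC
    hRm hRe hRu hCm hCe hCu _ _ _ rfl rfl rfl
  refine ⟨_, _, _, _, fun a b => (key a b).1, ?_⟩
  calc _ ≤ ∑ _a : Fin r, ∑ _b : Fin r, 4 * d :=
        Finset.sum_le_sum fun a _ => Finset.sum_le_sum fun b _ => (key a b).2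
    _ = 4 * d * r ^ 2 := by simp [Finset.sum_const, Finset.card_univ, Fintype.card_fin]; ring

end Summit.MatrixMultiplication.MatrixMultiplication.Cruxes.HiddenCorners.Sketch
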